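/-
Origin: expansion seat `planner-pub-hodgecm-prl2-g5-0`, handover #6 2026-08-18T09:14:41Z doc-only (`HOME/pub-hodgecm-prl2-g5/lean/Prl2g5/ComponentTowerTwist.lean`, md5 42f77378, 388 lines);
landed by the gen-7 packager in gate run 27 REPLACES the earlier landed copy of `HodgeCM/StubTree/ComponentTowerTwist.lean` (import ^import Prl2g5\.TwistOrbit\b→import HodgeCM.Automorphic.TwistOrbit ×1; import ^import Prl2g5\.→import HodgeCM.StubTree. ×1).
-/
/-
Copyright: pub-hodgecm expansion lineage prl2 (REDUCE `RealisationExistsPerL` / `Face`), generation 5.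
Authors: planner-pub-hodgecm-prl2-g5-0.

# The (P∘U) seam `CompTower.deepen` DERIVED from primitive twist seams (REDUCTION-v5 §R.12(b′), §R.13(5))

ADDITIVE to `HodgeCM.StubTree.ComponentTower` (gen 5, run 26) and `HodgeCM.Automorphic.TwistOrbit` (gen 5): nothing landed
changes.  `IsoDatum.CompTower D Hk` posits DEEP SUPPORT `deepen` as ONE composite field, justified in prose (ComponentTower
module docstring, (P∘U)).  Here the same dictionary is re-typed as `IsoDatum.TwistTower D Hk`: the nineteen `CompTower` fields
other than `deepen`, verbatim, plus the following PRIMITIVE entries, each a one-line unfolding of a definition of the intended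
model `𝓗 ⊂ L²(G_U(L⁺)\G_U(𝔸_{L⁺}))` (`T := det G_U = U(1)_{L/L⁺}`, `C_K := T(L⁺)\T(𝔸_{L⁺,f})/det K`):

 (U) `Ksub Γ ≤ G` — the level subgroup `K_Γ`;  (D) `vec_fix` — `vec_Γ c` is right-`K_Γ`-invariant.
 (U) `X` — the group of (unitary, automatically finite-order) characters of the compact totally disconnected abelian group
     `T(L⁺)\T(𝔸_{L⁺,f})`; `tw π χ` — its action `τ ↦ τ ⊗ χ∘det` on the classes of the block `[π]` (`tw_one`, `tw_mul`), which is
     TRANSITIVE (`tw_trans`): the block IS one twist orbit (ComponentTower M1 (b); this is the definition of `D.A`).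
 (D) `Utw χ` — multiplication by `χ(det g_f)`, a unitary representation of `X` on `𝓗` (`χ∘det` is left-`G_U(L⁺)`-invariant and
     of modulus one); `Utw_mem` — it carries the `τ`-isotypic subspace into the `τ ⊗ χ∘det`-isotypic subspace, because of
     (D) `comm` — `R(g) U_χ = χ(det g) U_χ R(g)` (`twc χ g = χ(det g)`): evaluate both sides at `x`, `det(xg) = det x · det g`.
 (U) `Xfix Γ = Ĉ_Γ ≤ X` — the characters trivial on `det K_Γ`, a FINITE subgroup (`≅ (C_Γ)^∧`, `C_Γ` finite: listed as the
     finset `XfixS Γ`); `sep` — `χ(det k) = ψ(det k)` for all `k ∈ K_Γ` says `χ⁻¹ψ ∈ Ĉ_Γ` (tautology).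
 (D) `Utw_fix` — `vec_Γ c` is supported on the identity component `{x : det x_f ∈ T(L⁺)·det K_Γ}` of level `K_Γ`, where
     `χ∘det ≡ 1` for `χ ∈ Ĉ_Γ`.
 (D) `isoSupp` — FINITE ISOTYPIC SUPPORT at a fixed level: `vec_Γ c` (`c` a block-`[π]` class) is a finite sum of NONZERO vectors
     in distinct isotypic subspaces of the block.  (The `K_Γ`-fixed projections `P_τ vec_Γ c` are pairwise orthogonal vectors of
     the finite-dimensional `𝓗^{K_Γ}` = the `(2,0)`-forms of level `K_Γ`, so finitely many are nonzero; a class `τ` with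
     `τ^{K_Γ} ≠ 0` has finite multiplicity for the same reason, so its isotypic subspace is closed.)
 (U∘D) `deepLevel` — DEEP LEVELS and the CUT-OFF IDENTITY (ComponentTower M1 (a)): for two levels and finitely many twists
     `S ⊂ X` there is a common deeper level `Γ″` (take `K″ ⊂ K_Γ ∩ K_{Γ′}` with `det K″ ⊂ ker χ` for `χ ∈ S` — kernels of characters
     of a profinite group are open) with tower coverings `F : P_{Γ″} → P_Γ`, `F′ : P_{Γ″} → P_{Γ′}` (inclusions of levels), such that
     `S ⊂ Ĉ_{Γ″}` and pull-back is the twist average: `vec_{Γ″}(F^*c) = 𝟙_{identity component of K″}·vec_Γ c =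
     |C_{Γ″}|⁻¹ Σ_{χ ∈ Ĉ_{Γ″}} U_χ vec_Γ c` (orthogonality of characters of the finite abelian group `C_{Γ″}`).

KERNEL (this file): `TwistTower.deepen` — the `deepen` statement for a `TwistTower`, from these primitives and
`RepDecomp.twist_deepen` / `twistComp_ne_zero` (TwistOrbit): isotypic subspaces of distinct classes are pairwise orthogonal
(`RepDecomp.isotypic_orthogonal`) and `R`-invariant (`RepDecomp.isotypic_invariant`); the finite group `Ĉ_{Γ″}` acts on the block;
`vec d` is fixed by `U(Ĉ_{Γ′} ∩ Ĉ_{Γ″})` and `R(K_{Γ′})`; every component of its twist average over `Ĉ_{Γ″}·supp(d) ⊇ supp(c)` is nonzero;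
the twist average of `vec c` is nonzero by the same theorem on the `c`-side (`RepDecomp.twistAvg_ne_zero`).  Hence
`TwistTower.toCompTower`, the packages `MatsushimaTwistFree{Face,PerL}` and the end theorems `COR_CM_of_liu_twist`,
`perL_of_liu_twist` — same hypotheses as `COR_CM_of_liu_comp` with the seam census: (D) `vec, vec_inj, κ, pair_vec, coeff,
tr_comp, vec_proj, vec_fix, Utw, Utw_unitary, Utw_mem, comm, Utw_fix, isoSupp`; (U) `ι, cls, cls_inj, Ksub, X, tw, tw_trans, Xfix,
sep, deepLevel`; (P, BY NAME) `MultOne`; NO composite (P∘U) seam.  THE OBSTRUCTION (P♮₂) `FreeObstruction` is unchanged.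
Standard axioms only.
-/
import Summits.HodgeConjecture.HodgeCM.StubTree.ComponentTower
import Summits.HodgeConjecture.HodgeCM.Automorphic.TwistOrbit

noncomputable section

open scoped BigOperators InnerProductSpace

namespace HodgeCM

/-! ## 0. One more abstract lemma: the twist average of a suitably fixed vector is nonzero -/

namespace RepDecomp

open HodgeCM.PerL34.Spectral (IsUnitaryRep)

variable {H : Type*} [NormedAddCommGroup H] [InnerProductSpace ℂ H]
variable {ι X : Type*} [Group X] [Fintype X] [MulAction X ι]
variable {U : X →* (H →L[ℂ] H)} (W : ι → Submodule ℂ H) {K : Type*} [Group K]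

/-- **The twist average of a nonzero vector with the symmetry of `twistComp_ne_zero` is nonzero**: its components over the
orbit of the (nonempty) support are nonzero and pairwise orthogonal. -/
theorem twistAvg_ne_zero [DecidableEq ι] (hW : OrthFamily W) (hU : IsUnitaryRep U)
    (hUW : ∀ (χ : X) (i : ι) (v : H), v ∈ W i → U χ v ∈ W (χ • i))
    {ρ : K →* (H →L[ℂ] H)} (hρ : IsUnitaryRep ρ) (hρW : ∀ (k : K) (i : ι) (v : H), v ∈ W i → ρ k v ∈ W i)
    (c : X → K → ℂ) (hcomm : ∀ (χ : X) (k : K) (v : H), ρ k (U χ v) = c χ k • U χ (ρ k v))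
    (X' : Subgroup X) (hsep : ∀ χ ψ : X, c χ = c ψ → χ⁻¹ * ψ ∈ X')
    (s : Finset ι) (d : ι → H) (hd : ∀ i ∈ s, d i ∈ W i) (hd0 : ∀ i ∈ s, d i ≠ 0) (hne : s.Nonempty)
    (hfixU : ∀ η ∈ X', U η (∑ i ∈ s, d i) = ∑ i ∈ s, d i) (hfixρ : ∀ k : K, ρ k (∑ i ∈ s, d i) = ∑ i ∈ s, d i) :
    twistAvg U (∑ i ∈ s, d i) ≠ 0 := by
  have hO : StableFinset X (orbitFinset X s) := stableFinset_orbitFinset s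
  let d' : ι → H := fun i => if i ∈ s then d i else 0
  have hd' : ∀ i, d' i ∈ W i := by
    intro i
    by_cases hi : i ∈ s
    · simp only [d', hi, if_true]; exact hd i hi
    · simp only [d', hi, if_false]; exact Submodule.zero_mem _
  have hvd : ∑ i ∈ s, d i = ∑ i ∈ orbitFinset X s, d' i := by
    have h1 : ∑ i ∈ s, d i = ∑ i ∈ s, d' i :=
      Finset.sum_congr rfl (fun i hi => by simp only [d', hi, if_true])
    rw [h1]
    exact Finset.sum_subset (subset_orbitFinset s) (fun i _ hi => by simp only [d', hi, if_false])
  have hfixU' : ∀ η ∈ X', U η (∑ i ∈ orbitFinset X s, d' i) = ∑ i ∈ orbitFinset X s, d' i := by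
    intro η hη; rw [← hvd]; exact hfixU η hη
  have hfixρ' : ∀ k : K, ρ k (∑ i ∈ orbitFinset X s, d' i) = ∑ i ∈ orbitFinset X s, d' i := by
    intro k; rw [← hvd]; exact hfixρ k
  obtain ⟨i₀, hi₀⟩ := hne
  rw [hvd, twistAvg_eq_sum_twistComp hO d']
  intro h0
  have hall := hW.eq_zero_of_sum_eq_zero (fun j _ => twistComp_mem W hUW d' hd' j) h0
  have hne0 : twistComp U d' i₀ ≠ 0 := by
    refine twistComp_ne_zero W hW hU hUW hρ hρW c hcomm X' hsep hO d' hd' hfixU' hfixρ'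
      (subset_orbitFinset s hi₀) (χ₀ := 1) ?_
    rw [inv_one, one_smul]
    simp only [d', hi₀, if_true]
    exact hd0 i₀ hi₀
  exact hne0 (hall i₀ (subset_orbitFinset s hi₀))

end RepDecomp

namespace Universe

open Literature.AlgebraicGeometry.Motives
open HodgeCM.PerL34.Spectral (IsUnitaryRep)
open HodgeCM.RepDecomp (IsoClass Members isotypic MultiplicityOne)

namespace IsoDatum

variable {U : Universe} {L : CMField} {ι₁ : L →+* ℂ} {V : HermSpace3 L ι₁} (D : U.IsoDatum V) (Hk : U.HeckeData)

/-- **The component-aware tower dictionary with PRIMITIVE twist seams** (module docstring): the fields of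
`IsoDatum.CompTower` except `deepen`, verbatim, followed by the primitive (D)/(U) entries from which `deepen` is DERIVED
(`TwistTower.deepen`). -/
structure TwistTower : Type 1 where
  /-- the group (intended `G_U(𝔸_{L⁺,f})`) -/
  G : Type
  [grp : Group G]
  /-- the Hilbert space of `(2,0)`-type forms of all levels -/
  H : Type
  [nacg : NormedAddCommGroup H]
  [ips : InnerProductSpace ℂ H]
  [cs : CompleteSpace H]
  /-- the representation (right translation) -/
  R : G →* (H →L[ℂ] H)
  /-- it is unitary -/
  unitary : IsUnitaryRep R
  /-- **(D)** the class-to-form map at level `Γ` (extension by zero off the identity component; meaningful on `F²`) -/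
  vec : (Γ : Level V) → (U.CohC (U.pms L ι₁ V Γ) 2 →ₗ[ℂ] H)
  /-- **(D)** … injective on `F²` -/
  vec_inj : ∀ (Γ : Level V) (c : U.CohC (U.pms L ι₁ V Γ) 2), c ∈ U.F2 Γ → vec Γ c = 0 → c = 0
  /-- **(D)** the level-dependent constant of `∫_{P_Γ} c ∪ \bar d` against the Petersson product … -/
  κ : Level V → ℂ
  /-- … nonzero at every level -/
  κ_ne : ∀ Γ : Level V, κ Γ ≠ 0
  /-- **(D)** `∫_{P_Γ} c ∪ \bar d = κ_Γ · ⟪vec d, vec c⟫` on `F²(P_Γ)` -/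
  pair_vec : ∀ (Γ : Level V) (c d : U.CohC (U.pms L ι₁ V Γ) 2), c ∈ U.F2 Γ → d ∈ U.F2 Γ →
    U.pair2 (U.pms L ι₁ V Γ) c d = κ Γ * ⟪vec Γ d, vec Γ c⟫_ℂ
  /-- **(D) MATRIX COEFFICIENTS ARE PERIOD SUMS** (as in `CompTower.coeff`). -/
  coeff : ∀ (g : G) (Γ₁ Γ₂ : Level V), ∃ (n : ℕ) (Γs : Fin n → Level V)
      (F : (j : Fin n) → U.Mor (U.pms L ι₁ V (Γs j)) (U.pms L ι₁ V Γ₁))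
      (F' : (j : Fin n) → U.Mor (U.pms L ι₁ V (Γs j)) (U.pms L ι₁ V Γ₂)) (a : Fin n → ℂ),
      (∀ j, F j ∈ Hk.tr Γ₁ (Γs j)) ∧ (∀ j, F' j ∈ Hk.tr Γ₂ (Γs j)) ∧
      ∀ x ∈ U.F2 Γ₁, ∀ y ∈ U.F2 Γ₂, ⟪R g (vec Γ₂ y), vec Γ₁ x⟫_ℂ =
        ∑ j, a j * U.pair2 (U.pms L ι₁ V (Γs j)) (U.pullC (F j) 2 x) (U.pullC (F' j) 2 y)
  /-- **(D)** tower coverings compose. -/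
  tr_comp : ∀ (Γ Γ' Γ'' : Level V), ∀ F ∈ Hk.tr Γ Γ', ∀ F' ∈ Hk.tr Γ' Γ'', U.comp F' F ∈ Hk.tr Γ Γ''
  /-- **(U)** the index of the block of a constituent `π` (the twist orbit `X_f·π`; NO finiteness) … -/
  ι : D.A → Type
  /-- … its unitary-equivalence classes … -/
  cls : (π : D.A) → ι π → IsoClass R
  /-- … pairwise DISTINCT -/
  cls_inj : ∀ π, Function.Injective (cls π)
  /-- **(D, seam iii)** under `vec`, `proj_π` is the orthogonal projection onto the closed block. -/
  vec_proj : ∀ (π : D.A) (Γ : Level V) (c : U.CohC (U.pms L ι₁ V Γ) 2), c ∈ U.F2 Γ →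
    vec Γ (D.proj Γ π c) = (⨆ i, isotypic R (cls π i)).topologicalClosure.starProjection (vec Γ c)
  -- ===== the primitive twist seams replacing `CompTower.deepen` =====
  /-- **(U)** the level subgroup `K_Γ ≤ G_U(𝔸_f)` -/
  Ksub : Level V → Subgroup G
  /-- **(D)** `vec_Γ c` is right-`K_Γ`-invariant -/
  vec_fix : ∀ (Γ : Level V) (c : U.CohC (U.pms L ι₁ V Γ) 2), c ∈ U.F2 Γ → ∀ k ∈ Ksub Γ, R k (vec Γ c) = vec Γ c
  /-- **(U)** the twist group: the characters of `T(L⁺)\T(𝔸_{L⁺,f})` -/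
  X : Type
  [grpX : Group X]
  /-- **(U)** its action `τ ↦ τ ⊗ χ∘det` on the classes of the block `[π]` … -/
  tw : (π : D.A) → X → ι π → ι π
  /-- … is an action … -/
  tw_one : ∀ (π : D.A) (i : ι π), tw π 1 i = i
  /-- … -/
  tw_mul : ∀ (π : D.A) (χ ψ : X) (i : ι π), tw π (χ * ψ) i = tw π χ (tw π ψ i)
  /-- **(U)** … and TRANSITIVE: the block is ONE twist orbit (M1 (b)) -/
  tw_trans : ∀ (π : D.A) (i j : ι π), ∃ χ : X, tw π χ i = j
  /-- **(D)** `U_χ` = multiplication by `χ∘det`, a representation of `X` on `𝓗` … -/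
  Utw : X →* (H →L[ℂ] H)
  /-- … unitary … -/
  Utw_unitary : IsUnitaryRep Utw
  /-- **(D)** … carrying the `τ`-isotypic subspace into the `τ ⊗ χ∘det`-isotypic subspace -/
  Utw_mem : ∀ (π : D.A) (χ : X) (i : ι π) (v : H), v ∈ isotypic R (cls π i) → Utw χ v ∈ isotypic R (cls π (tw π χ i))
  /-- **(D)** the commutation characters `twc χ g = χ(det g)` … -/
  twc : X → G → ℂ
  /-- … `R(g) U_χ = χ(det g) U_χ R(g)` -/
  comm : ∀ (χ : X) (g : G) (v : H), R g (Utw χ v) = twc χ g • Utw χ (R g v)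
  /-- **(U)** `Ĉ_Γ ≤ X`: the characters trivial on `det K_Γ` … -/
  Xfix : Level V → Subgroup X
  /-- … a FINITE subgroup, listed … -/
  XfixS : Level V → Finset X
  /-- … by this finset -/
  mem_XfixS : ∀ (Γ : Level V) (χ : X), χ ∈ XfixS Γ ↔ χ ∈ Xfix Γ
  /-- **(U)** separation: `χ(det k) = ψ(det k)` on `K_Γ` means `χ⁻¹ψ ∈ Ĉ_Γ` -/
  sep : ∀ (Γ : Level V) (χ ψ : X), (∀ k ∈ Ksub Γ, twc χ k = twc ψ k) → χ⁻¹ * ψ ∈ Xfix Γ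
  /-- **(D)** `vec_Γ c` lives on the identity component of level `K_Γ`, where `χ∘det ≡ 1` for `χ ∈ Ĉ_Γ` -/
  Utw_fix : ∀ (Γ : Level V) (c : U.CohC (U.pms L ι₁ V Γ) 2), c ∈ U.F2 Γ → ∀ χ ∈ Xfix Γ, Utw χ (vec Γ c) = vec Γ c
  /-- **(D)** FINITE ISOTYPIC SUPPORT of a block class at a fixed level, all components nonzero -/
  isoSupp : ∀ (π : D.A) (Γ : Level V) (c : U.CohC (U.pms L ι₁ V Γ) 2), c ∈ U.F2 Γ → D.proj Γ π c = c →
    ∃ (s : Finset (ι π)) (e : ι π → H), (∀ i ∈ s, e i ∈ isotypic R (cls π i)) ∧ (∀ i ∈ s, e i ≠ 0) ∧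
      vec Γ c = ∑ i ∈ s, e i
  /-- **(U∘D)** DEEP LEVELS and the CUT-OFF IDENTITY (M1 (a)): a common deeper level whose `Ĉ` contains finitely many given
  twists, with tower coverings along which pull-back is the twist average over `Ĉ_{Γ″}`. -/
  deepLevel : ∀ (Γ Γ' : Level V) (S : Finset X), ∃ (Γ'' : Level V), ∃ F ∈ Hk.tr Γ Γ'', ∃ F' ∈ Hk.tr Γ' Γ'',
      (∀ χ ∈ S, χ ∈ Xfix Γ'') ∧
      (∀ c ∈ U.F2 Γ, vec Γ'' (U.pullC F 2 c) = ((XfixS Γ'').card : ℂ)⁻¹ • ∑ χ ∈ XfixS Γ'', Utw χ (vec Γ c)) ∧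
      (∀ d ∈ U.F2 Γ', vec Γ'' (U.pullC F' 2 d) = ((XfixS Γ'').card : ℂ)⁻¹ • ∑ χ ∈ XfixS Γ'', Utw χ (vec Γ' d))

attribute [instance] TwistTower.grp TwistTower.nacg TwistTower.ips TwistTower.cs TwistTower.grpX

namespace TwistTower

variable {D Hk}

/-- The twist action on the classes of a block, as a `MulAction`. -/
instance instMulAction (T : D.TwistTower Hk) (π : D.A) : MulAction T.X (T.ι π) where
  smul := T.tw π
  one_smul := T.tw_one π
  mul_smul := T.tw_mul π

/-- (Ported verbatim from the HodgeCMPerL package; no docstring in the source.) -/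
theorem smul_def (T : D.TwistTower Hk) (π : D.A) (χ : T.X) (i : T.ι π) : χ • i = T.tw π χ i := rfl

/-- **(P, BY NAME) MULTIPLICITY ONE** for the classes of every block (as `CompTower.MultOne`; [Rog90] §14.6 for the inner form
`G′ = G_U`, `2 ≤ d`: p. 242 exhaustion, Prop 14.6.2 + proof p. 243 (stable packets, READING), Thm 14.6.4, Thm 14.6.5 — typed in
`HodgeCM/Literature/RogawskiMultiplicityOne.lean`, `PacketClasses.discrete_mult_le_one`; Thm 13.3.3(c) is the quasi-split
analogue; wording per GAPS cfR4-N1). -/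
def MultOne (T : D.TwistTower Hk) : Prop := ∀ (π : D.A) (i : T.ι π), MultiplicityOne T.R (T.cls π i)

/-- **DEEP SUPPORT DERIVED** (KERNEL): the statement of `CompTower.deepen` holds for a `TwistTower`. -/
theorem deepen (T : D.TwistTower Hk) (π : D.A) (Γ Γ' : Level V) (c : U.CohC (U.pms L ι₁ V Γ) 2)
    (d : U.CohC (U.pms L ι₁ V Γ') 2) (hc : c ∈ U.F2 Γ) (hd : d ∈ U.F2 Γ') (hpc : D.proj Γ π c = c)
    (hpd : D.proj Γ' π d = d) (hc0 : c ≠ 0) (hd0 : d ≠ 0) :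
    ∃ (Γ₁ Γ₂ : Level V), ∃ F ∈ Hk.tr Γ Γ₁, ∃ F' ∈ Hk.tr Γ' Γ₂, ∃ (s : Finset (T.ι π)) (e : T.ι π → T.H),
      (∀ i ∈ s, e i ∈ isotypic T.R (T.cls π i)) ∧ (∀ i ∈ s, e i ≠ 0) ∧
      T.vec Γ₂ (U.pullC F' 2 d) = ∑ i ∈ s, e i ∧
      T.vec Γ₁ (U.pullC F 2 c) ∈ (⨆ i ∈ s, isotypic T.R (T.cls π i)).topologicalClosure ∧
      T.vec Γ₁ (U.pullC F 2 c) ≠ 0 := by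
  classical
  -- finite isotypic supports of `vec c`, `vec d`
  obtain ⟨t, cc, hcc, hcc0, hvc⟩ := T.isoSupp π Γ c hc hpc
  obtain ⟨s, dd, hdd, hdd0, hvd⟩ := T.isoSupp π Γ' d hd hpd
  have hvc0 : T.vec Γ c ≠ 0 := fun h => hc0 (T.vec_inj Γ c hc h)
  have hvd0 : T.vec Γ' d ≠ 0 := fun h => hd0 (T.vec_inj Γ' d hd h)
  have htne : t.Nonempty := by
    by_contra h; rw [Finset.not_nonempty_iff_eq_empty] at h
    exact hvc0 (by rw [hvc, h, Finset.sum_empty])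
  have hsne : s.Nonempty := by
    by_contra h; rw [Finset.not_nonempty_iff_eq_empty] at h
    exact hvd0 (by rw [hvd, h, Finset.sum_empty])
  obtain ⟨i₀, hi₀⟩ := hsne
  -- twists carrying `i₀` to every class; a deep level realising those needed for `supp(c)`
  choose f hf using fun j => T.tw_trans π i₀ j
  obtain ⟨Γ'', F, hF, F', hF', hS, hcutC, hcutD⟩ := T.deepLevel Γ Γ' (t.image f)
  -- the finite twist group `Ĉ_{Γ″}` and the restricted objects
  haveI : Fintype ↥(T.Xfix Γ'') := Fintype.subtype (T.XfixS Γ'') (fun x => T.mem_XfixS Γ'' x)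
  let W : T.ι π → Submodule ℂ T.H := fun i => isotypic T.R (T.cls π i)
  have hW : RepDecomp.OrthFamily W := by
    intro i j hij u hu v hv
    exact (RepDecomp.isotypic_orthogonal T.unitary ((T.cls_inj π).ne hij)).inner_eq hu hv
  let Ug : ↥(T.Xfix Γ'') →* (T.H →L[ℂ] T.H) := T.Utw.comp (T.Xfix Γ'').subtype
  have hUg : IsUnitaryRep Ug := fun χ u v => T.Utw_unitary χ.1 u v
  have hUgW : ∀ (χ : ↥(T.Xfix Γ'')) (i : T.ι π) (v : T.H), v ∈ W i → Ug χ v ∈ W (χ • i) :=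
    fun χ i v hv => T.Utw_mem π χ.1 i v hv
  have havg : ∀ v : T.H, RepDecomp.twistAvg Ug v = ((T.XfixS Γ'').card : ℂ)⁻¹ • ∑ χ ∈ T.XfixS Γ'', T.Utw χ v := by
    intro v
    unfold RepDecomp.twistAvg
    rw [Fintype.card_of_subtype (T.XfixS Γ'') (fun x => T.mem_XfixS Γ'' x)]
    congr 1
    exact (Finset.sum_subtype (T.XfixS Γ'') (fun x => T.mem_XfixS Γ'' x) (fun χ => T.Utw χ v)).symm
  -- the symmetry data of a block class at a level `Γ₀` with `Ĉ_{Γ₀} ≤ Ĉ_{Γ″}`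
  have side : ∀ (Γ₀ : Level V) (x : U.CohC (U.pms L ι₁ V Γ₀) 2) (hx : x ∈ U.F2 Γ₀)
      (s₀ : Finset (T.ι π)) (e₀ : T.ι π → T.H) (hvx : T.vec Γ₀ x = ∑ i ∈ s₀, e₀ i),
      ∃ (ρ : ↥(T.Ksub Γ₀) →* (T.H →L[ℂ] T.H)) (cg : ↥(T.Xfix Γ'') → ↥(T.Ksub Γ₀) → ℂ) (X' : Subgroup ↥(T.Xfix Γ'')),
        IsUnitaryRep ρ ∧ (∀ (k : ↥(T.Ksub Γ₀)) (i : T.ι π) (v : T.H), v ∈ W i → ρ k v ∈ W i) ∧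
        (∀ (χ : ↥(T.Xfix Γ'')) (k : ↥(T.Ksub Γ₀)) (v : T.H), ρ k (Ug χ v) = cg χ k • Ug χ (ρ k v)) ∧
        (∀ χ ψ : ↥(T.Xfix Γ''), cg χ = cg ψ → χ⁻¹ * ψ ∈ X') ∧
        (∀ η ∈ X', Ug η (∑ i ∈ s₀, e₀ i) = ∑ i ∈ s₀, e₀ i) ∧
        (∀ k : ↥(T.Ksub Γ₀), ρ k (∑ i ∈ s₀, e₀ i) = ∑ i ∈ s₀, e₀ i) := by
    intro Γ₀ x hx s₀ e₀ hvx
    refine ⟨T.R.comp (T.Ksub Γ₀).subtype, fun χ k => T.twc χ.1 k.1, (T.Xfix Γ₀).subgroupOf (T.Xfix Γ''),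
      fun k u v => T.unitary k.1 u v, fun k i v hv => RepDecomp.isotypic_invariant (T.cls π i) k.1 v hv,
      fun χ k v => T.comm χ.1 k.1 v, ?_, ?_, ?_⟩
    · intro χ ψ h
      rw [Subgroup.mem_subgroupOf, Subgroup.coe_mul, Subgroup.coe_inv]
      exact T.sep Γ₀ χ.1 ψ.1 (fun k hk => by simpa using congr_fun h ⟨k, hk⟩)
    · intro η hη
      rw [← hvx]
      exact T.Utw_fix Γ₀ x hx η.1 (Subgroup.mem_subgroupOf.mp hη)
    · intro k
      rw [← hvx]
      exact T.vec_fix Γ₀ x hx k.1 k.2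
  obtain ⟨ρd, cgd, Xd, hρd, hρdW, hcommd, hsepd, hfixUd, hfixρd⟩ := side Γ' d hd s dd hvd
  obtain ⟨ρc, cgc, Xc, hρc, hρcW, hcommc, hsepc, hfixUc, hfixρc⟩ := side Γ c hc t cc hvc
  -- `supp(c)` inside the `Ĉ_{Γ″}`-orbit of `supp(d)`
  have ht : t ⊆ RepDecomp.orbitFinset ↥(T.Xfix Γ'') s := by
    intro j hj
    exact RepDecomp.mem_orbitFinset.mpr ⟨⟨f j, hS (f j) (Finset.mem_image_of_mem f hj)⟩, i₀, hi₀, hf j⟩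
  -- the `c`-side twist average is nonzero
  have hc0' : RepDecomp.twistAvg Ug (∑ i ∈ t, cc i) ≠ 0 :=
    RepDecomp.twistAvg_ne_zero W hW hUg hUgW hρc hρcW cgc hcommc Xc hsepc t cc hcc hcc0 htne hfixUc hfixρc
  -- DEEP SUPPORT from `twist_deepen`
  obtain ⟨S, e, he, he0, hdec, hmem, hne⟩ :=
    RepDecomp.twist_deepen W hW hUg hUgW hρd hρdW cgd hcommd Xd hsepd s dd hdd hdd0 hfixUd hfixρd t cc hcc ht hc0'
  refine ⟨Γ'', Γ'', F, hF, F', hF', S, e, he, he0, ?_, ?_, ?_⟩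
  · rw [hcutD d hd, ← havg, hvd]; exact hdec
  · rw [hcutC c hc, ← havg, hvc]; exact Submodule.le_topologicalClosure _ hmem
  · rw [hcutC c hc, ← havg, hvc]; exact hne

/-- **The `CompTower` of a `TwistTower`**: `deepen` is now a theorem. -/
def toCompTower (T : D.TwistTower Hk) : D.CompTower Hk where
  G := T.G
  H := T.H
  R := T.R
  unitary := T.unitary
  vec := T.vec
  vec_inj := T.vec_inj
  κ := T.κ
  κ_ne := T.κ_ne
  pair_vec := T.pair_vec
  coeff := T.coeff
  tr_comp := T.tr_comp
  ι := T.ι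
  cls := T.cls
  cls_inj := T.cls_inj
  vec_proj := T.vec_proj
  deepen := T.deepen

/-- (Ported verbatim from the HodgeCMPerL package; no docstring in the source.) -/
theorem multOne_toCompTower (T : D.TwistTower Hk) : T.toCompTower.MultOne ↔ T.MultOne := Iff.rfl

end TwistTower

end IsoDatum

/-! ### Packaging and end theorems -/

variable (U : Universe) (Hk : U.HeckeData)

/-- **Matsushima + twist-tower package (face binders)**: at every admissible face a Matsushima model whose isotypic datum
carries a tower dictionary with PRIMITIVE twist seams and multiplicity one (by name), and THE OBSTRUCTION (P♮₂). -/
def MatsushimaTwistFreeFace : Prop :=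
  ∀ (F : CMField), IsGalois ℚ F → 6 ≤ Module.finrank ℚ F →
    ∀ (f : Face F) (ι₁ : F →+* ℂ), f.Admissible ι₁ → ∀ V : HermSpace3 F ι₁,
      ∃ (Pi : Type) (_ : DecidableEq Pi) (𝔐 : U.MatsushimaDatum V Hk Pi),
        (∃ T : 𝔐.isoDatum.TwistTower Hk, T.MultOne) ∧ 𝔐.isoDatum.FreeObstruction F f.psi ι₁

/-- The same under the PerL binders. -/
def MatsushimaTwistFreePerL : Prop :=
  ∀ (K L : CMField) (j : K →+* L), IsNormalClosure ℚ K L →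
    Module.finrank ℚ K = 6 → (Module.finrank ℚ L = 24 ∨ Module.finrank ℚ L = 48) →
    ∀ (φ : Fin 3 → (K →+* ℂ)), IsFrame φ →
    ∀ (ι₁ : L →+* ℂ), ι₁.comp j = φ 0 →
    ∀ (t : Fin 4 → CMType K), IsPerLTypes φ t →
    ∀ V : HermSpace3 L ι₁,
      ∃ (Pi : Type) (_ : DecidableEq Pi) (𝔐 : U.MatsushimaDatum V Hk Pi),
        (∃ T : 𝔐.isoDatum.TwistTower Hk, T.MultOne) ∧ 𝔐.isoDatum.FreeObstruction K t (φ 0)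

variable {U Hk}

/-- Twist-tower package ⇒ component-tower package (face binders). -/
theorem matsushimaCompFreeFace_of_twist (h : U.MatsushimaTwistFreeFace Hk) : U.MatsushimaCompFreeFace Hk := by
  intro F hG h6 f ι₁ hadm V
  obtain ⟨Pi, hdec, 𝔐, ⟨T, hM⟩, hO⟩ := h F hG h6 f ι₁ hadm V
  exact ⟨Pi, hdec, 𝔐, ⟨T.toCompTower, T.multOne_toCompTower.mpr hM⟩, hO⟩

/-- Twist-tower package ⇒ component-tower package (PerL binders). -/
theorem matsushimaCompFreePerL_of_twist (h : U.MatsushimaTwistFreePerL Hk) : U.MatsushimaCompFreePerL Hk := by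
  intro K L j hN hK hL φ hφ ι₁ hι t ht V
  obtain ⟨Pi, hdec, 𝔐, ⟨T, hM⟩, hO⟩ := h K L j hN hK hL φ hφ ι₁ hι t ht V
  exact ⟨Pi, hdec, 𝔐, ⟨T.toCompTower, T.multOne_toCompTower.mpr hM⟩, hO⟩

variable (U)

/-- **COR-CM (gen 5, R.12(b′))**: `HC_CM` from the 28 model facts, von Neumann density (PRINT), (S) `LiuSupplyFace`
(PRINT ∧ Dict), and at every face a Matsushima dictionary carrying a tower dictionary with PRIMITIVE twist seams and
multiplicity one by name — (I5), (I6) AND DEEP SUPPORT all DERIVED — and THE OBSTRUCTION (P♮₂) `FreeObstruction`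
(PerL v5 §3.3, not in print); plus `PohlmannSpan` and `Qw8Sufficiency`. -/
theorem COR_CM_of_liu_twist (M : U.ModelAxioms) (hvN : Literature.VonNeumann.DoubleCommutantDensity)
    (hL : U.LiuSupplyFace) {Hk : U.HeckeData} (hI : U.MatsushimaTwistFreeFace Hk) (hPo : U.PohlmannSpan)
    (hQ : U.Qw8Sufficiency) : U.HC_CM :=
  COR_CM_of_liu_comp U M hvN hL (matsushimaCompFreeFace_of_twist hI) hPo hQ

/-- **PerL (`W_per^L`)** from the same inputs under the PerL binders. -/
theorem perL_of_liu_twist (M : U.ModelAxioms) (hvN : Literature.VonNeumann.DoubleCommutantDensity)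
    (hL : U.LiuSupplyPerL) {Hk : U.HeckeData} (hI : U.MatsushimaTwistFreePerL Hk) : U.PerL :=
  perL_of_liu_comp U M hvN hL (matsushimaCompFreePerL_of_twist hI)

end Universe

end HodgeCM

end
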